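import Mathlib.Analysis.Calculus.ContDiff.Operations
import Mathlib.Analysis.Calculus.FDeriv.Comp
import Mathlib.Topology.ContinuousMap.Algebra
import Mathlib.Topology.ContinuousMap.Compact
import Literature.Analysis.UnboundedOperators.SemilinearMildTubeShift
import HarnessLib

/-!
# Continuation of the smooth mild flow along a reference trajectory: the induction step

Analysis/UnboundedOperators support file (everything proved; no definitions, no named facts).  The step
of the continuation argument behind "mild solutions in a tube" (D. Henry, *Geometric Theory of
Semilinear Parabolic Equations*, LNM 840 (1981), Thm. 3.3.4 (continuation), Thm. 3.4.1 (Lipschitz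
dependence), Thm. 3.4.4 / Cor. 3.4.6 (smooth dependence, derivative = solution of the linearisation)).

Setting: `T(t)` a strongly continuous semigroup, `K(t)` weakly singular (`‖K(t)‖ ≤ C t^{−α}`, `α < 1`),
strongly continuous on `(0, ∞)` and intertwined (`K(s + t) = T(s) K(t)`), `N` bounded bilinear, `f ∈ E`;
a local flow `Ψ : E → C([0, τ]; E)` on the window `[0, τ]`, `C^∞` on the ball `‖x‖ < ρ`, giving mild
solutions bounded by `ρ + 1` whose derivative solves the linearised equation (the sibling
`SemilinearMildTubeLocal.lean`); a continuous reference mild solution `Yc` on `[0, L]` with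
`‖Yc‖ + 2 ≤ ρ`; a Lipschitz stability constant `Lip` for mild solutions bounded by `ρ + 1`
(`SemilinearMildTubeLipschitz.lean`) and a tube radius `δ` with `Lip δ ≤ 1`.

`mildTube_step`: if `U : E → (ℝ → E)` is a family of curves which, for data `y` in the ball
`B = B(Yc(0), δ)`, is continuous, solves the mild equation from `y` on `[0, a]`, stays within
`Lip ‖y − Yc(0)‖` of `Yc`, is `C^∞` in `y` at every fixed time, with `t ↦ D(U · t)(y) h` continuous and
solving the linearised mild equation on `[0, a]`, then the continued family

  `U' y t = U y t` (`t ≤ a`),  `U' y t = Ψ (U y a) (t − a)` (`t ≥ a`)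

has the same six properties on `[0, a + τ]` (`a + τ ≤ L`).  Ingredients: the junction value
`U y a` lies in the ball `‖x‖ < ρ` (tube estimate), so `Ψ` restarts there; the mild and linearised
identities concatenate by `duhamel_concat` (`SemilinearMildTubeShift.lean`); per-time smoothness and the
formula `D(U' · t)(y) h = DΨ(U y a)[D(U · a)(y) h](t − a)` are the chain rule through the evaluation
functional `C([0, τ]; E) →L E`; the tube estimate on `[0, a + τ]` is the Lipschitz stability against
`Yc` (both curves are bounded by `ρ + 1`).  The iteration over the windows and the packaging as a map
into `C([0, L]; E)` are in `SemilinearMildTube.lean`.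

## References

* D. Henry, *Geometric Theory of Semilinear Parabolic Equations*, LNM 840, Springer (1981), Thm. 3.3.4,
  Thm. 3.4.1, Thm. 3.4.4, Cor. 3.4.6. [Henry1981]
* A. Pazy, *Semigroups of Linear Operators and Applications to Partial Differential Equations*, Springer
  (1983), §6.3, Thm. 6.3.1. [Pazy1983]
-/

noncomputable section

open Set Filter MeasureTheory intervalIntegral Metric
open _root_.Topology
open scoped ContDiff

namespace Literature.Analysis.UnboundedOperators

variable {E : Type*} [NormedAddCommGroup E] [NormedSpace ℝ E] [CompleteSpace E]

/-- **Continuation step of the smooth mild flow in a tube** (Henry 1981, Thm. 3.3.4, Thm. 3.4.1,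
Cor. 3.4.6).  In the setting of the module docstring: if the family `U` has, for data `y` in the ball
`B(Yc 0, δ)`, the six properties [continuity in `t`; mild identity from `y` on `[0, a]`; tube estimate
`‖U y t − Yc t‖ ≤ Lip ‖y − Yc 0‖` on `[0, a]`; `y ↦ U y t` is `C^∞` on the ball for every `t`;
`t ↦ D(U · t)(y) h` continuous; linearised mild identity on `[0, a]`], then so does the family `U'`
continued by the local flow `Ψ` from the junction values `U y a`, on `[0, a + τ]`. [folklore] -/
theorem mildTube_step (T K : ℝ → E →L[ℝ] E) (hT0 : T 0 = 1)
    (hTadd : ∀ s t, 0 ≤ s → 0 ≤ t → T (s + t) = (T s).comp (T t))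
    (hTc : ∀ y : E, Continuous fun t : ℝ => T t y) {α C : ℝ} (hα : α < 1)
    (hK : ∀ t, 0 < t → ‖K t‖ ≤ C * t ^ (-α))
    (hKadd : ∀ s t, 0 ≤ s → 0 < t → K (s + t) = (T s).comp (K t))
    (hKc : ∀ y : E, ContinuousOn (fun t : ℝ => K t y) (Ioi 0)) (N : E →L[ℝ] E →L[ℝ] E) (f : E)
    {ρ τ : ℝ} (hτ : 0 < τ) {Ψ : E → C(Icc (0 : ℝ) τ, E)} (hΨs : ContDiffOn ℝ ∞ Ψ (ball 0 ρ))
    (hΨm : ∀ x ∈ ball (0 : E) ρ, ∀ t : Icc (0 : ℝ) τ,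
      Ψ x t = T t x + (∫ s in (0 : ℝ)..(t : ℝ), T ((t : ℝ) - s) f) -
        ∫ s in (0 : ℝ)..(t : ℝ), K ((t : ℝ) - s)
          (N (Ψ x (projIcc 0 τ hτ.le s)) (Ψ x (projIcc 0 τ hτ.le s))))
    (hΨb : ∀ x ∈ ball (0 : E) ρ, ∀ t : Icc (0 : ℝ) τ, ‖Ψ x t‖ ≤ ρ + 1)
    (hΨd : ∀ x ∈ ball (0 : E) ρ, ∀ (k : E) (t : Icc (0 : ℝ) τ),
      fderiv ℝ Ψ x k t = T t k - ∫ s in (0 : ℝ)..(t : ℝ), K ((t : ℝ) - s)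
        (N (Ψ x (projIcc 0 τ hτ.le s)) (fderiv ℝ Ψ x k (projIcc 0 τ hτ.le s)) +
          N (fderiv ℝ Ψ x k (projIcc 0 τ hτ.le s)) (Ψ x (projIcc 0 τ hτ.le s))))
    {Yc : ℝ → E} {L : ℝ} (hYc : Continuous Yc)
    (hYm : ∀ t ∈ Icc 0 L, Yc t = T t (Yc 0) + (∫ s in (0 : ℝ)..t, T (t - s) f) -
      ∫ s in (0 : ℝ)..t, K (t - s) (N (Yc s) (Yc s)))
    (hYb : ∀ t, ‖Yc t‖ + 2 ≤ ρ) {Lip δ : ℝ} (hLip0 : 0 ≤ Lip)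
    (hLip : ∀ L' ≤ L, ∀ (u v : ℝ → E) (x x' : E), Continuous u → Continuous v →
      (∀ t ∈ Icc 0 L', u t = T t x + (∫ s in (0 : ℝ)..t, T (t - s) f) -
        ∫ s in (0 : ℝ)..t, K (t - s) (N (u s) (u s))) →
      (∀ t ∈ Icc 0 L', v t = T t x' + (∫ s in (0 : ℝ)..t, T (t - s) f) -
        ∫ s in (0 : ℝ)..t, K (t - s) (N (v s) (v s))) →
      (∀ t ∈ Icc 0 L', ‖u t‖ ≤ ρ + 1) → (∀ t ∈ Icc 0 L', ‖v t‖ ≤ ρ + 1) →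
      ∀ t ∈ Icc 0 L', ‖u t - v t‖ ≤ Lip * ‖x - x'‖)
    (hLδ : Lip * δ ≤ 1) {a : ℝ} (ha : 0 ≤ a) (haL : a + τ ≤ L) {U U' : E → ℝ → E}
    (hA : ∀ y ∈ ball (Yc 0) δ, Continuous (U y))
    (hB : ∀ y ∈ ball (Yc 0) δ, ∀ t ∈ Icc 0 a, U y t = T t y + (∫ s in (0 : ℝ)..t, T (t - s) f) -
      ∫ s in (0 : ℝ)..t, K (t - s) (N (U y s) (U y s)))
    (hC : ∀ y ∈ ball (Yc 0) δ, ∀ t ∈ Icc 0 a, ‖U y t - Yc t‖ ≤ Lip * ‖y - Yc 0‖)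
    (hD : ∀ t, ContDiffOn ℝ ∞ (fun y => U y t) (ball (Yc 0) δ))
    (hE : ∀ y ∈ ball (Yc 0) δ, ∀ h : E, Continuous fun t => fderiv ℝ (fun z => U z t) y h)
    (hF : ∀ y ∈ ball (Yc 0) δ, ∀ h : E, ∀ t ∈ Icc 0 a,
      fderiv ℝ (fun z => U z t) y h = T t h - ∫ s in (0 : ℝ)..t, K (t - s)
        (N (U y s) (fderiv ℝ (fun z => U z s) y h) + N (fderiv ℝ (fun z => U z s) y h) (U y s)))
    (hU' : ∀ y t, U' y t = if t ≤ a then U y t else Ψ (U y a) (projIcc 0 τ hτ.le (t - a))) :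
    (∀ y ∈ ball (Yc 0) δ, Continuous (U' y)) ∧
    (∀ y ∈ ball (Yc 0) δ, ∀ t ∈ Icc 0 (a + τ), U' y t = T t y + (∫ s in (0 : ℝ)..t, T (t - s) f) -
      ∫ s in (0 : ℝ)..t, K (t - s) (N (U' y s) (U' y s))) ∧
    (∀ y ∈ ball (Yc 0) δ, ∀ t ∈ Icc 0 (a + τ), ‖U' y t - Yc t‖ ≤ Lip * ‖y - Yc 0‖) ∧
    (∀ t, ContDiffOn ℝ ∞ (fun y => U' y t) (ball (Yc 0) δ)) ∧
    (∀ y ∈ ball (Yc 0) δ, ∀ h : E, Continuous fun t => fderiv ℝ (fun z => U' z t) y h) ∧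
    (∀ y ∈ ball (Yc 0) δ, ∀ h : E, ∀ t ∈ Icc 0 (a + τ),
      fderiv ℝ (fun z => U' z t) y h = T t h - ∫ s in (0 : ℝ)..t, K (t - s)
        (N (U' y s) (fderiv ℝ (fun z => U' z s) y h) +
          N (fderiv ℝ (fun z => U' z s) y h) (U' y s))) := by
  -- ### the junction values lie in the ball `‖x‖ < ρ`
  have hUb : ∀ y ∈ ball (Yc 0) δ, ∀ t ∈ Icc 0 a, ‖U y t‖ ≤ ρ - 1 := by
    intro y hy t ht
    have h1 : ‖U y t - Yc t‖ ≤ 1 :=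
      (hC y hy t ht).trans ((mul_le_mul_of_nonneg_left (mem_ball_iff_norm.1 hy).le hLip0).trans hLδ)
    linarith [norm_le_insert' (U y t) (Yc t), hYb t]
  have hxball : ∀ y ∈ ball (Yc 0) δ, U y a ∈ ball (0 : E) ρ := fun y hy =>
    mem_ball_zero_iff.2 (by linarith [hUb y hy a ⟨ha, le_rfl⟩])
  -- ### the two branches and their agreement at the junction
  have hJ0 : ∀ y t, t ≤ a → U' y t = U y t := fun y t ht => by rw [hU', if_pos ht]
  have hJ0' : ∀ t, t ≤ a → (fun z => U' z t) = fun z => U z t := fun t ht =>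
    funext fun z => hJ0 z t ht
  have hΨ0 : ∀ x ∈ ball (0 : E) ρ, Ψ x (projIcc 0 τ hτ.le 0) = x := fun x hx => by
    rw [projIcc_left, hΨm x hx]
    simp [hT0]
  have hJ1 : ∀ y ∈ ball (Yc 0) δ, ∀ t, a ≤ t → U' y t = Ψ (U y a) (projIcc 0 τ hτ.le (t - a)) := by
    intro y hy t ht
    rcases ht.eq_or_lt with rfl | hlt
    · rw [hJ0 y a le_rfl, sub_self, hΨ0 _ (hxball y hy)]
    · rw [hU', if_neg (not_le.2 hlt)]
  have hfun : ∀ t, ¬t ≤ a → (fun z => U' z t) =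
      (⇑(ContinuousMap.evalCLM ℝ (projIcc 0 τ hτ.le (t - a))) ∘ Ψ) ∘ fun z => U z a := by
    intro t hta
    funext z
    simp only [Function.comp_apply, ContinuousMap.evalCLM_apply, hU', if_neg hta]
  -- ### (A) continuity in time
  have hA' : ∀ y ∈ ball (Yc 0) δ, Continuous (U' y) := by
    intro y hy
    have h : U' y = fun t => if t ≤ a then U y t else Ψ (U y a) (projIcc 0 τ hτ.le (t - a)) :=
      funext (hU' y)
    rw [h]
    exact Continuous.if_le (hA y hy)
      (((Ψ (U y a)).continuous.comp continuous_projIcc).comp (continuous_id.sub continuous_const))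
      continuous_id continuous_const fun t ht => by rw [ht, sub_self, hΨ0 _ (hxball y hy)]
  -- ### (B) the mild identity on `[0, a + τ]` (concatenation)
  have h1 : ∀ y ∈ ball (Yc 0) δ, ∀ t ∈ Icc 0 a, U' y t = T t y +
      (∫ s in (0 : ℝ)..t, T (t - s) f) - ∫ s in (0 : ℝ)..t, K (t - s) (N (U' y s) (U' y s)) := by
    intro y hy t ht
    rw [hJ0 y t ht.2, hB y hy t ht]
    congr 1
    refine intervalIntegral.integral_congr fun s hs => ?_
    rw [uIcc_of_le ht.1] at hs
    rw [hJ0 y s (hs.2.trans ht.2)]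
  have h2 : ∀ y ∈ ball (Yc 0) δ, ∀ t ∈ Icc a (a + τ), U' y t = T (t - a) (U' y a) +
      (∫ s in (0 : ℝ)..(t - a), T (t - a - s) f) -
        ∫ s in (0 : ℝ)..(t - a), K (t - a - s) (N (U' y (a + s)) (U' y (a + s))) := by
    intro y hy t ht
    have hr : t - a ∈ Icc 0 τ := ⟨sub_nonneg.2 ht.1, by linarith [ht.2]⟩
    rw [hJ1 y hy t ht.1, hJ0 y a le_rfl, projIcc_of_mem hτ.le hr, hΨm (U y a) (hxball y hy) ⟨t - a, hr⟩]
    congr 1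
    refine intervalIntegral.integral_congr fun s hs => ?_
    rw [uIcc_of_le hr.1] at hs
    rw [hJ1 y hy (a + s) (le_add_of_nonneg_right hs.1), add_sub_cancel_left]
  have hG : ∀ y ∈ ball (Yc 0) δ, Continuous fun s => N (U' y s) (U' y s) := fun y hy =>
    (N.continuous.comp (hA' y hy)).clm_apply (hA' y hy)
  have hB' : ∀ y ∈ ball (Yc 0) δ, ∀ t ∈ Icc 0 (a + τ), U' y t = T t y +
      (∫ s in (0 : ℝ)..t, T (t - s) f) - ∫ s in (0 : ℝ)..t, K (t - s) (N (U' y s) (U' y s)) :=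
    fun y hy => duhamel_concat hα hTadd hTc hK hKadd hKc f (hG y hy) ha (h1 y hy) (h2 y hy)
  -- ### (C) the tube estimate on `[0, a + τ]` (Lipschitz stability against `Yc`)
  have hU'b : ∀ y ∈ ball (Yc 0) δ, ∀ t ∈ Icc 0 (a + τ), ‖U' y t‖ ≤ ρ + 1 := by
    intro y hy t ht
    by_cases hta : t ≤ a
    · rw [hJ0 y t hta]
      linarith [hUb y hy t ⟨ht.1, hta⟩]
    · rw [hJ1 y hy t (not_le.1 hta).le]
      exact hΨb _ (hxball y hy) _
  have hC' : ∀ y ∈ ball (Yc 0) δ, ∀ t ∈ Icc 0 (a + τ), ‖U' y t - Yc t‖ ≤ Lip * ‖y - Yc 0‖ :=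
    fun y hy => hLip (a + τ) haL (U' y) Yc y (Yc 0) (hA' y hy) hYc (hB' y hy)
      (fun s hs => hYm s ⟨hs.1, hs.2.trans haL⟩) (hU'b y hy)
      (fun s _ => by linarith [hYb s, norm_nonneg (Yc s)])
  -- ### (D) smoothness in the datum at every fixed time (chain rule through evaluation)
  have hD' : ∀ t, ContDiffOn ℝ ∞ (fun y => U' y t) (ball (Yc 0) δ) := by
    intro t
    by_cases hta : t ≤ a
    · rw [hJ0' t hta]; exact hD t
    · rw [hfun t hta]
      exact ((ContinuousMap.evalCLM ℝ _).contDiff.comp_contDiffOn hΨs).comp (hD a)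
        fun y hy => hxball y hy
  -- ### the derivative after the junction: `D(U' · t)(y) h = DΨ(U y a)[D(U · a)(y) h](t - a)`
  have hJ2 : ∀ y ∈ ball (Yc 0) δ, ∀ (h : E) (t : ℝ), a ≤ t → fderiv ℝ (fun z => U' z t) y h =
      fderiv ℝ Ψ (U y a) (fderiv ℝ (fun z => U z a) y h) (projIcc 0 τ hτ.le (t - a)) := by
    intro y hy h t ht
    rcases ht.eq_or_lt with rfl | hlt
    · rw [hJ0' a le_rfl, sub_self, projIcc_left, hΨd _ (hxball y hy)]
      simp [hT0]
    · rw [hfun t (not_le.2 hlt)]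
      have hg : HasFDerivAt (fun z => U z a) (fderiv ℝ (fun z => U z a) y) y :=
        (((hD a).differentiableOn (by simp)).differentiableAt (isOpen_ball.mem_nhds hy)).hasFDerivAt
      have hΨ' : HasFDerivAt Ψ (fderiv ℝ Ψ (U y a)) (U y a) :=
        ((hΨs.differentiableOn (by simp)).differentiableAt
          (isOpen_ball.mem_nhds (hxball y hy))).hasFDerivAt
      rw [(((ContinuousMap.evalCLM ℝ (projIcc 0 τ hτ.le (t - a))).hasFDerivAt.comp (U y a) hΨ').comp
        y hg).fderiv]
      rfl
  -- ### (E) continuity of `t ↦ D(U' · t)(y) h`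
  have hE' : ∀ y ∈ ball (Yc 0) δ, ∀ h : E, Continuous fun t => fderiv ℝ (fun z => U' z t) y h := by
    intro y hy h
    have heq : (fun t => fderiv ℝ (fun z => U' z t) y h) = fun t =>
        if t ≤ a then fderiv ℝ (fun z => U z t) y h
        else fderiv ℝ Ψ (U y a) (fderiv ℝ (fun z => U z a) y h) (projIcc 0 τ hτ.le (t - a)) := by
      funext t
      split_ifs with hta
      · rw [hJ0' t hta]
      · exact hJ2 y hy h t (not_le.1 hta).le
    rw [heq]
    refine Continuous.if_le (hE y hy h) (((fderiv ℝ Ψ (U y a) _).continuous.comp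
      continuous_projIcc).comp (continuous_id.sub continuous_const)) continuous_id continuous_const
      fun t ht => ?_
    have hj := hJ2 y hy h a le_rfl
    rw [hJ0' a le_rfl] at hj
    rw [ht]
    exact hj
  -- ### (F) the linearised identity on `[0, a + τ]` (concatenation with `f = 0`)
  have hF' : ∀ y ∈ ball (Yc 0) δ, ∀ h : E, ∀ t ∈ Icc 0 (a + τ),
      fderiv ℝ (fun z => U' z t) y h = T t h - ∫ s in (0 : ℝ)..t, K (t - s)
        (N (U' y s) (fderiv ℝ (fun z => U' z s) y h) +
          N (fderiv ℝ (fun z => U' z s) y h) (U' y s)) := by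
    intro y hy h
    have hGc : Continuous fun s => N (U' y s) (fderiv ℝ (fun z => U' z s) y h) +
        N (fderiv ℝ (fun z => U' z s) y h) (U' y s) :=
      ((N.continuous.comp (hA' y hy)).clm_apply (hE' y hy h)).add
        ((N.continuous.comp (hE' y hy h)).clm_apply (hA' y hy))
    have k1 : ∀ t ∈ Icc 0 a, fderiv ℝ (fun z => U' z t) y h = T t h +
        (∫ s in (0 : ℝ)..t, T (t - s) (0 : E)) - ∫ s in (0 : ℝ)..t, K (t - s)
          (N (U' y s) (fderiv ℝ (fun z => U' z s) y h) +
            N (fderiv ℝ (fun z => U' z s) y h) (U' y s)) := by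
      intro t ht
      rw [hJ0' t ht.2, hF y hy h t ht]
      simp only [map_zero, intervalIntegral.integral_zero, add_zero]
      congr 1
      refine intervalIntegral.integral_congr fun s hs => ?_
      rw [uIcc_of_le ht.1] at hs
      rw [hJ0' s (hs.2.trans ht.2), hJ0 y s (hs.2.trans ht.2)]
    have k2 : ∀ t ∈ Icc a (a + τ), fderiv ℝ (fun z => U' z t) y h =
        T (t - a) (fderiv ℝ (fun z => U' z a) y h) +
        (∫ s in (0 : ℝ)..(t - a), T (t - a - s) (0 : E)) - ∫ s in (0 : ℝ)..(t - a), K (t - a - s)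
          (N (U' y (a + s)) (fderiv ℝ (fun z => U' z (a + s)) y h) +
            N (fderiv ℝ (fun z => U' z (a + s)) y h) (U' y (a + s))) := by
      intro t ht
      have hr : t - a ∈ Icc 0 τ := ⟨sub_nonneg.2 ht.1, by linarith [ht.2]⟩
      rw [hJ2 y hy h t ht.1, hJ0' a le_rfl, projIcc_of_mem hτ.le hr,
        hΨd (U y a) (hxball y hy) _ ⟨t - a, hr⟩]
      simp only [map_zero, intervalIntegral.integral_zero, add_zero]
      congr 1
      refine intervalIntegral.integral_congr fun s hs => ?_
      rw [uIcc_of_le hr.1] at hs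
      rw [hJ1 y hy (a + s) (le_add_of_nonneg_right hs.1),
        hJ2 y hy h (a + s) (le_add_of_nonneg_right hs.1), add_sub_cancel_left]
    intro t ht
    have := duhamel_concat hα hTadd hTc hK hKadd hKc (0 : E) hGc ha k1 k2 t ht
    simpa only [map_zero, intervalIntegral.integral_zero, add_zero] using this
  exact ⟨hA', hB', hC', hD', hE', hF'⟩

end Literature.Analysis.UnboundedOperators

end
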